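/-
Copyright (c) 2026. All rights reserved.
Released under Apache 2.0 license as described in the file LICENSE.
Authors: abc-iut cell, wave-3 discharge seat abc-iut-L6-d2 (gen 3) ([AbsTopIII] Prop 5.8 (i)–(iii):
abc-iut-L4-t3's hypothesis structure `MonoAnalyticNonarchAlgorithm` INHABITED by the genuine
construction — `out G :=` the model at `G_E`, `E ⊆ ℚ̄_p`, transported along `G ≅ G_E`; the
isomorphism-invariance of `(p, f, e, m)` from the tree's PROVED [AbsAnab] Prop 1.2.1).
-/
import Literature.AnabelianGeometry.AbsoluteAnabelian.MonoAnalyticNonarchModel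
import Literature.AnabelianGeometry.AbsoluteAnabelian.MLFGaloisGroupsHolds
import Literature.AnabelianGeometry.AbsoluteAnabelian.MLFTorsionCardProofs
import Literature.IUT.LogVolume.FundamentalIdentity
import HarnessLib

/-!
# [AbsTopIII] Prop 5.8 (i)–(iii): the group-theoretic algorithm `G ↦ MonoAnalyticNonarch G` EXISTS (honest model)

S. Mochizuki, *Topics in absolute anabelian geometry III* [MochizukiAbsTopIII2015], Prop 5.8 (i)
manuscript p. 139: "there is a functorial [i.e., relative to `TG⊢`] group-theoretic algorithm
`G ↦ (p_G, f_G, e_G, m_G, ...)`" and (ii)–(iii) pp. 139–140 (the `Γ⃗×_non`-diagram, the log-shell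
`ℐ(G)`, the log-volume `μ^log(G)`), quoting [AbsAnab] Prop 1.2.1 for the invariants. abc-iut-L4-t3
typed the whole algorithm as the HYPOTHESIS STRUCTURE `MonoAnalyticNonarchAlgorithm` (fields `out :
∀ G, IsMLFGaloisType G → MonoAnalyticNonarch G` and `inv_eq_of_iso`: isomorphic `G`'s get the same
`(p, f, e, m)`), noting that "an `∃`-statement without the comparison to `k` would be vacuous".

THIS FILE INHABITS IT with the comparison built in (sub-DAG row P58ii/A of
plan/L4/SUBDAG-AbsTopIII-Prop58ii-Cor52v.md; DAG node AbsTopIII:Prop5.8(ii)):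

* `IsMLF.exists_galEquiv_padicSubfield`: an MLF `k` (the cell's `IsMLF`: finite over some `ℚ_p`)
  embeds into `ℚ̄_p` with image a finite `E`, and `G_k ≃ G_E` as topological groups
  (`galEquivFieldRange`; independence of the algebraic closure + change of base along `k ≅ E`);
* `MonoAnalyticNonarchAlgorithm.model`: `out G hG := (MonoAnalyticNonarch.ofPadicSubfield E).comap e`
  for a CHOSEN presentation `e : G ≃ₜ* G_E` (from `hG : IsMLFGaloisType G`), i.e. every field of
  `out G` is the real object of `MonoAnalyticNonarchModel.lean` seen through `e`;
* `inv_eq_of_iso` = `MLFType.ofPadicSubfield_eq_of_galEquiv`: `G_{E₁} ≅ G_{E₂}` forces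
  `(p, f, e, m)(E₁) = (p, f, e, m)(E₂)` — `p` and `[E : ℚ_p] = e·f` by the tree's PROVED [AbsAnab]
  Prop 1.2.1 (i), (v) (`galoisMLF_iso_residueChar_eq_holds`, `galoisMLF_iso_degrees_holds`), and
  `#μ(E) = p^m·(p^f - 1)` (abc-iut-S1's `card_torsionUnits`) because it equals the order of the
  torsion subgroup of `G_E^ab`, a group-theoretic invariant (`natCard_torsion_absoluteGaloisGroupAbelianization`:
  local class field theory as proved in the tree — the reciprocity map is injective with
  `θ(𝒪_E^×) = [I_E]`, `closure [G, G] ≤ I_E` and `G_E/I_E` torsion-free; this is the all-torsion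
  form of abc-iut-L4-t11's `mlf_torsion_card_holds`).

HONEST FRAMING: classical; our kernel check that the typed interface is inhabited by the genuine
construction at `G ≅ G_k`; nothing here bears on [IUTchIII] Cor. 3.12; typed ≠ discharged.
-/

set_option autoImplicit false

noncomputable section

namespace Literature.AnabelianGeometry.AbsoluteAnabelian

open Set ValuativeRel Field Module
open scoped ValuativeRel Pointwise NNReal
open Literature.NumberTheory.GaloisRepresentations Literature.NumberTheory.Transcendental
open Literature.IUT.LogVolume (residueDegree absRamificationIdx torsionPExp torsionUnits
  card_torsionUnits absRamificationIdx_mul_residueDegree residueDegree_pos)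
open scoped Literature.IUT.LogVolume

/-! ## The torsion of `G_K^ab` is `μ(K)` (all-torsion form of `mlf_torsion_card`) -/

section Torsion

variable (K : Type*) [Field K] [ValuativeRel K] [TopologicalSpace K] [IsNonarchimedeanLocalField K]

/-- **`#(G_K^ab)_tors = #μ(K)`** for a non-archimedean local field `K`: a reciprocity map
`θ : K^× → G_K^ab` (injective, `θ(𝒪_K^×) = [I_K]`) restricts to a bijection from the roots of unity
of `K` onto the torsion of `G_K^ab` — a torsion class `[σ]`, `[σ]^n = 1`, has
`σ^n ∈ closure [G_K, G_K] ≤ I_K`, so `σ ∈ I_K` (`G_K/I_K ≅ Ẑ` is torsion-free), so `[σ] = θ(u)` with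
`u^n = 1`. ([AbsAnab] proof of Prop 1.2.1 p. 11; Prop 5.8 (i): "`p^{m_G}`".)
[cite: MochizukiAbsTopIII2015, Prop 5.8 (i) p. 139] -/
theorem natCard_torsion_absoluteGaloisGroupAbelianization :
    Nat.card (CommGroup.torsion (absoluteGaloisGroupAbelianization K)) =
      Nat.card (CommGroup.torsion Kˣ) := by
  classical
  obtain ⟨θ, hθ⟩ := exists_isLocalReciprocityMap_holds K
  have hCI : (commutator (absoluteGaloisGroup K)).topologicalClosure ≤ absInertia K :=
    WeilGroup.topologicalClosure_commutator_absGalois_le_absInertia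
      (WeilGroup.denseRange_toAbsGalois_holds K)
  let Φ : CommGroup.torsion Kˣ → CommGroup.torsion (absoluteGaloisGroupAbelianization K) :=
    fun u => ⟨θ u.1, (CommGroup.mem_torsion _).mpr (θ.isOfFinOrder ((CommGroup.mem_torsion _).mp u.2))⟩
  refine (Nat.card_congr (Equiv.ofBijective Φ ⟨?_, ?_⟩)).symm
  · intro u v h
    exact Subtype.ext (hθ.injective (congrArg Subtype.val h))
  · rintro ⟨t, ht⟩
    obtain ⟨n, hn, htn⟩ := (isOfFinOrder_iff_pow_eq_one).mp ((CommGroup.mem_torsion _).mp ht)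
    obtain ⟨σ, rfl⟩ := QuotientGroup.mk_surjective t
    have hσn : σ ^ n ∈ absInertia K := by
      apply hCI
      rw [← QuotientGroup.eq_one_iff, QuotientGroup.mk_pow]
      exact htn
    have hσ : σ ∈ absInertia K := mem_absInertia_of_pow_mem hn hσn
    have hmem : (QuotientGroup.mk σ : absoluteGaloisGroupAbelianization K) ∈
        ((absInertia K).map (absGaloisAbProj K)) := ⟨σ, hσ, rfl⟩
    rw [← hθ.map_unitGroup] at hmem
    obtain ⟨u, -, hu⟩ := hmem
    have hun : u ^ n = 1 := by
      apply hθ.injective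
      rw [map_pow, hu, map_one, ← QuotientGroup.mk_pow]
      exact htn
    exact ⟨⟨u, (CommGroup.mem_torsion _).mpr ((isOfFinOrder_iff_pow_eq_one).mpr ⟨n, hn, hun⟩)⟩,
      Subtype.ext hu⟩

end Torsion

/-- A group isomorphism preserves the order of the torsion subgroup. [folklore] -/
private theorem natCard_torsion_congr {A B : Type*} [CommGroup A] [CommGroup B] (e : A ≃* B) :
    Nat.card (CommGroup.torsion A) = Nat.card (CommGroup.torsion B) := by
  refine Nat.card_congr (Equiv.ofBijective
    (fun x : CommGroup.torsion A => (⟨e x.1, (CommGroup.mem_torsion _).mpr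
      (e.toMonoidHom.isOfFinOrder ((CommGroup.mem_torsion _).mp x.2))⟩ : CommGroup.torsion B)) ⟨?_, ?_⟩)
  · intro x y h
    exact Subtype.ext (e.injective (congrArg Subtype.val h))
  · rintro ⟨y, hy⟩
    refine ⟨⟨e.symm y, (CommGroup.mem_torsion _).mpr ?_⟩, Subtype.ext (e.apply_symm_apply y)⟩
    have h := e.symm.toMonoidHom.isOfFinOrder ((CommGroup.mem_torsion _).mp hy)
    simpa using h

/-! ## `(p, f, e, m)` of `E ⊆ ℚ̄_p` is an invariant of `G_E` -/

section Invariance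

variable {p₁ p₂ : ℕ} [Fact p₁.Prime] [Fact p₂.Prime]
  (E₁ : IntermediateField ℚ_[p₁] (PadicAlgCl p₁)) [FiniteDimensional ℚ_[p₁] E₁]
  (E₂ : IntermediateField ℚ_[p₂] (PadicAlgCl p₂)) [FiniteDimensional ℚ_[p₂] E₂]

/-- `#μ(E)` is a group-theoretic invariant of `G_E`: the order of the torsion of `G_E^ab`.
[cite: MochizukiAbsTopIII2015, Prop 5.8 (i) p. 139] -/
theorem natCard_torsionUnits_eq_natCard_torsion_abelianization {p : ℕ} [Fact p.Prime]
    (E : IntermediateField ℚ_[p] (PadicAlgCl p)) [FiniteDimensional ℚ_[p] E] :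
    Nat.card (torsionUnits E) =
      Nat.card (CommGroup.torsion (absoluteGaloisGroupAbelianization E)) := by
  letI := PadicAlgCl.subfieldValuativeRel E
  haveI := PadicAlgCl.isNonarchimedeanLocalField_subfield E
  rw [natCard_torsion_absoluteGaloisGroupAbelianization]
  rfl

/-- **[AbsAnab] Prop 1.2.1 ⇒ Prop 5.8 (i): `(p, f, e, m)` depends only on the topological group `G_E`.**
For finite `E₁ ⊆ ℚ̄_{p₁}`, `E₂ ⊆ ℚ̄_{p₂}` with `G_{E₁} ≅ G_{E₂}`: `p₁ = p₂` (Prop 1.2.1 (i), PROVED in the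
tree), `e₁·f₁ = [E₁ : ℚ_p] = [E₂ : ℚ_p] = e₂·f₂` (Prop 1.2.1 (v), PROVED), and
`p^{m₁}·(p^{f₁} - 1) = #μ(E₁) = #(G^ab)_tors = #μ(E₂) = p^{m₂}·(p^{f₂} - 1)`; hence `f₁ = f₂`,
`m₁ = m₂`, `e₁ = e₂`. [cite: MochizukiAbsTopIII2015, Prop 5.8 (i) p. 139] -/
theorem MLFType.ofPadicSubfield_eq_of_galEquiv (α : absoluteGaloisGroup E₁ ≃ₜ* absoluteGaloisGroup E₂) :
    MLFType.ofPadicSubfield E₁ = MLFType.ofPadicSubfield E₂ := by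
  have hp : p₁ = p₂ := galoisMLF_iso_residueChar_eq_holds p₁ p₂ E₁ E₂ ⟨α⟩
  subst hp
  -- `[E₁ : ℚ_p] = [E₂ : ℚ_p]`
  have hn : finrank ℚ_[p₁] E₁ = finrank ℚ_[p₁] E₂ := (galoisMLF_iso_degrees_holds p₁ p₁ E₁ E₂ ⟨α⟩).1
  -- `#μ(E₁) = #μ(E₂)`
  have hT : Nat.card (torsionUnits E₁) = Nat.card (torsionUnits E₂) := by
    rw [natCard_torsionUnits_eq_natCard_torsion_abelianization,
      natCard_torsionUnits_eq_natCard_torsion_abelianization]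
    exact natCard_torsion_congr
      (profiniteAbelianizationCongr (G := absoluteGaloisGrp E₁) (H := absoluteGaloisGrp E₂) α)
  have hprime : p₁.Prime := Fact.out
  -- `m₁ = m₂`
  have hm : torsionPExp p₁ E₁ = torsionPExp p₁ E₂ := by
    unfold Literature.IUT.LogVolume.torsionPExp
    rw [hT]
  -- `f₁ = f₂` from `p^{m}·(p^{f₁} - 1) = p^{m}·(p^{f₂} - 1)`
  have hf : residueDegree p₁ E₁ = residueDegree p₁ E₂ := by
    have h1 := card_torsionUnits p₁ E₁
    have h2 := card_torsionUnits p₁ E₂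
    rw [hT, hm] at h1
    have h := h1.symm.trans h2
    have hpm : 0 < p₁ ^ torsionPExp p₁ E₂ := pow_pos hprime.pos _
    have h' : p₁ ^ residueDegree p₁ E₁ - 1 = p₁ ^ residueDegree p₁ E₂ - 1 :=
      Nat.eq_of_mul_eq_mul_left hpm h
    have h1le : 1 ≤ p₁ ^ residueDegree p₁ E₁ := Nat.one_le_pow _ _ hprime.pos
    have h2le : 1 ≤ p₁ ^ residueDegree p₁ E₂ := Nat.one_le_pow _ _ hprime.pos
    apply Nat.pow_right_injective hprime.two_le
    dsimp only
    omega
  -- `e₁ = e₂` from `e·f = [E : ℚ_p]`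
  have he : absRamificationIdx p₁ E₁ = absRamificationIdx p₁ E₂ := by
    have h1 := absRamificationIdx_mul_residueDegree p₁ E₁
    have h2 := absRamificationIdx_mul_residueDegree p₁ E₂
    rw [hn, ← h2, hf] at h1
    exact Nat.eq_of_mul_eq_mul_right (residueDegree_pos p₁ E₂) h1
  simp only [MLFType.ofPadicSubfield, hf, he, hm]

end Invariance

/-! ## An MLF presented inside `ℚ̄_p`: `G_k ≅ G_E` for `E = ι(k)` -/

section Presentation

variable {p : ℕ} [Fact p.Prime] (k : Type) [Field k] [Algebra ℚ_[p] k] [Algebra.IsAlgebraic ℚ_[p] k]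
  (ι : k →ₐ[ℚ_[p]] PadicAlgCl p)

/-- Change of base field along `k ≅ ι(k) = E`: the `E`-automorphisms of `ℚ̄_p` are the `k`-automorphisms
(`k` acting through `ι`), as topological groups (restriction of scalars; Krull topologies; the
inverse is continuous by compactness). [folklore] -/
def PadicAlgCl.galRestrictScalarsEquiv :
    letI : Algebra k (PadicAlgCl p) := ι.toRingHom.toAlgebra
    (PadicAlgCl p ≃ₐ[ι.fieldRange] PadicAlgCl p) ≃ₜ* (PadicAlgCl p ≃ₐ[k] PadicAlgCl p) := by
  letI : Algebra k (PadicAlgCl p) := ι.toRingHom.toAlgebra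
  letI : Algebra k ι.fieldRange := ι.equivFieldRange.toAlgHom.toRingHom.toAlgebra
  haveI : IsScalarTower k ι.fieldRange (PadicAlgCl p) :=
    IsScalarTower.of_algebraMap_eq fun x => rfl
  haveI : IsScalarTower ℚ_[p] k (PadicAlgCl p) :=
    IsScalarTower.of_algebraMap_eq fun c => (ι.commutes c).symm
  haveI : Algebra.IsAlgebraic k (PadicAlgCl p) := Algebra.IsAlgebraic.tower_top (K := ℚ_[p]) k
  -- restriction of scalars as a group homomorphism
  let φ : (PadicAlgCl p ≃ₐ[ι.fieldRange] PadicAlgCl p) →* (PadicAlgCl p ≃ₐ[k] PadicAlgCl p) :=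
    { toFun := fun σ => σ.restrictScalars k
      map_one' := rfl
      map_mul' := fun _ _ => rfl }
  -- continuity (Krull topologies)
  have hcont : Continuous φ := by
    apply continuous_of_continuousAt_one φ (continuousAt_def.mpr _)
    intro N hN
    rw [map_one] at hN
    obtain ⟨M, _, hM⟩ := (krullTopology_mem_nhds_one_iff k (PadicAlgCl p) N).mp hN
    let b := Module.finBasis k M
    let S : Set (PadicAlgCl p) := Set.range fun i => (b i : PadicAlgCl p)
    let M' : IntermediateField ι.fieldRange (PadicAlgCl p) := IntermediateField.adjoin ι.fieldRange S
    haveI : FiniteDimensional ι.fieldRange M' :=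
      IntermediateField.finiteDimensional_adjoin fun x _ => Algebra.IsIntegral.isIntegral x
    refine (krullTopology_mem_nhds_one_iff ι.fieldRange (PadicAlgCl p) _).mpr
      ⟨M', inferInstance, fun σ hσ => hM ?_⟩
    rw [SetLike.mem_coe, IntermediateField.mem_fixingSubgroup_iff] at hσ
    rw [SetLike.mem_coe, IntermediateField.mem_fixingSubgroup_iff]
    have hb : ∀ i, φ σ (b i : PadicAlgCl p) = b i := fun i =>
      hσ _ (IntermediateField.subset_adjoin ι.fieldRange S ⟨i, rfl⟩)
    have key : ((φ σ).toLinearMap ∘ₗ M.val.toLinearMap) = M.val.toLinearMap :=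
      b.ext fun i => hb i
    intro x hx
    exact congr($key ⟨x, hx⟩)
  -- bijectivity
  have hinj : Function.Injective φ := fun σ τ h => AlgEquiv.restrictScalars_injective k h
  have hsurj : Function.Surjective φ := by
    intro τ
    refine ⟨{ τ.toRingEquiv with commutes' := fun y => ?_ }, AlgEquiv.ext fun _ => rfl⟩
    obtain ⟨x, hx⟩ := ι.mem_fieldRange.mp y.2
    have hy : algebraMap ι.fieldRange (PadicAlgCl p) y = algebraMap k (PadicAlgCl p) x := hx.symm
    change τ (algebraMap ι.fieldRange (PadicAlgCl p) y) = algebraMap ι.fieldRange (PadicAlgCl p) y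
    rw [hy, τ.commutes]
  let hφ : (PadicAlgCl p ≃ₐ[ι.fieldRange] PadicAlgCl p) ≃ₜ (PadicAlgCl p ≃ₐ[k] PadicAlgCl p) :=
    Continuous.homeoOfEquivCompactToT2 (f := Equiv.ofBijective φ ⟨hinj, hsurj⟩) hcont
  exact { MulEquiv.ofBijective φ ⟨hinj, hsurj⟩ with
    continuous_toFun := hcont
    continuous_invFun := hφ.symm.continuous }

/-- **`G_k ≅ G_E`, `E = ι(k) ⊆ ℚ̄_p`**: the absolute Galois group of an MLF `k` embedded into `ℚ̄_p` by
`ι` is, as a topological group, that of the subfield `ι(k)` (independence of the algebraic closure —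
the tree's `algEquivContinuousMulEquivAbsoluteGaloisGroup` — and `galRestrictScalarsEquiv`).
[cite: MochizukiAbsTopIII2015, Def 5.6 (i) p. 134] -/
def PadicAlgCl.galEquivFieldRange [CharZero k] :
    absoluteGaloisGroup k ≃ₜ* absoluteGaloisGroup ι.fieldRange :=
  letI : Algebra k (PadicAlgCl p) := ι.toRingHom.toAlgebra
  haveI : IsScalarTower ℚ_[p] k (PadicAlgCl p) :=
    IsScalarTower.of_algebraMap_eq fun c => (ι.commutes c).symm
  haveI : Algebra.IsAlgebraic k (PadicAlgCl p) := Algebra.IsAlgebraic.tower_top (K := ℚ_[p]) k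
  haveI : IsAlgClosure k (PadicAlgCl p) :=
    { isAlgClosed := inferInstance
      isAlgebraic := inferInstance }
  (algEquivContinuousMulEquivAbsoluteGaloisGroup k (PadicAlgCl p)).symm.trans
    ((PadicAlgCl.galRestrictScalarsEquiv k ι).symm.trans (PadicAlgCl.subfieldGalEquiv ι.fieldRange).symm)

end Presentation

/-- **Every MLF is presented inside some `ℚ̄_p`**: for `k` a finite extension of `ℚ_p` (the cell's
`IsMLF`), there is a finite `E ⊆ ℚ̄_p` with `G_k ≅ G_E` as topological groups (embed `k` by
`IsAlgClosed.lift`; `E := ι(k)`). [cite: MochizukiAbsTopIII2015, Def 5.6 (i) p. 134] -/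
theorem IsMLF.exists_galEquiv_padicSubfield {k : Type} [Field k] [CharZero k] (hk : IsMLF k) :
    ∃ (p : ℕ) (_ : Fact p.Prime) (E : IntermediateField ℚ_[p] (PadicAlgCl p)),
      FiniteDimensional ℚ_[p] E ∧ Nonempty (absoluteGaloisGroup k ≃ₜ* absoluteGaloisGroup E) := by
  obtain ⟨p, hp, f, hf⟩ := hk.exists_padic
  letI : Algebra ℚ_[p] k := f.toAlgebra
  haveI : Module.Finite ℚ_[p] k := hf
  haveI : Algebra.IsAlgebraic ℚ_[p] k := Algebra.IsAlgebraic.of_finite ℚ_[p] k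
  let ι : k →ₐ[ℚ_[p]] PadicAlgCl p := IsAlgClosed.lift
  haveI : FiniteDimensional ℚ_[p] ι.fieldRange :=
    LinearEquiv.finiteDimensional ι.equivFieldRange.toLinearEquiv
  exact ⟨p, hp, ι.fieldRange, inferInstance, ⟨PadicAlgCl.galEquivFieldRange k ι⟩⟩

/-! ## The algorithm, inhabited -/

namespace MonoAnalyticNonarchAlgorithm

/-- A presentation of `G ∈ Ob(TG⊢)` as `G ≅ G_E`, `E ⊆ ℚ̄_p` finite over `ℚ_p` (exists for every `G`
of MLF type: `IsMLF.exists_galEquiv_padicSubfield`). [cite: MochizukiAbsTopIII2015, Def 5.6 (i) p. 134] -/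
structure Presentation (G : ProfiniteGrp.{0}) : Type 1 where
  /-- the residue characteristic -/
  p : ℕ
  /-- it is prime -/
  [prime : Fact p.Prime]
  /-- the subfield `E ⊆ ℚ̄_p` -/
  E : IntermediateField ℚ_[p] (PadicAlgCl p)
  /-- `E` is finite over `ℚ_p` -/
  [finite : FiniteDimensional ℚ_[p] E]
  /-- `G ≅ G_E` -/
  iso : G ≃ₜ* absoluteGaloisGrp E

/-- Every `G` of MLF type has a presentation. [cite: MochizukiAbsTopIII2015, Def 5.6 (i) p. 134] -/
theorem nonempty_presentation (G : ProfiniteGrp.{0}) (hG : IsMLFGaloisType G) :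
    Nonempty (Presentation G) := by
  obtain ⟨k, _, _, hk, ⟨e⟩⟩ := hG
  obtain ⟨p, hp, E, hE, ⟨α⟩⟩ := hk.exists_galEquiv_padicSubfield
  haveI := hE
  exact ⟨{ p := p, E := E, iso := e.trans α }⟩

/-- A chosen presentation. [cite: MochizukiAbsTopIII2015, Def 5.6 (i) p. 134] -/
def presentation (G : ProfiniteGrp.{0}) (hG : IsMLFGaloisType G) : Presentation G :=
  Classical.choice (nonempty_presentation G hG)

/-- **[AbsTopIII] Prop 5.8 (i)–(iii), the algorithm INHABITED**: `out G :=` the model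
`MonoAnalyticNonarch.ofPadicSubfield E` at a chosen presentation `G ≅ G_E`, transported along the
isomorphism (so its carriers are `ℚ̄_p^×`, `𝒪^×_{ℚ̄_p}`, `(ℚ̄_p, +)`, its shell-arrow `log_k̄`, its
log-shell `ℐ_E`, its log-volume the Haar log-volume, its images the reciprocity images — with `G`
acting through `G ≅ G_E`); the reconstructed `(p, f, e, m)` is an isomorphism invariant by
`MLFType.ofPadicSubfield_eq_of_galEquiv` ([AbsAnab] Prop 1.2.1, proved in the tree).
[cite: MochizukiAbsTopIII2015, Prop 5.8 (i) p. 139] -/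
def model : MonoAnalyticNonarchAlgorithm.{0} where
  out G hG :=
    let P := presentation G hG
    haveI := P.prime
    haveI := P.finite
    letI : MeasurableSpace P.E := borel P.E
    haveI : BorelSpace P.E := ⟨rfl⟩
    (MonoAnalyticNonarch.ofPadicSubfield P.E).comap P.iso
  inv_eq_of_iso G H hG hH hGH := by
    obtain ⟨e⟩ := hGH
    haveI := (presentation G hG).prime
    haveI := (presentation G hG).finite
    haveI := (presentation H hH).prime
    haveI := (presentation H hH).finite
    exact MLFType.ofPadicSubfield_eq_of_galEquiv (presentation G hG).E (presentation H hH).E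
      ((presentation G hG).iso.symm.trans (e.trans (presentation H hH).iso))

/-- The reconstructed invariants of `model` at `G` are the `(p, f_E, e_E, m_E)` of (any) presenting
field `E`. [cite: MochizukiAbsTopIII2015, Prop 5.8 (i) p. 139] -/
theorem model_out_inv (G : ProfiniteGrp.{0}) (hG : IsMLFGaloisType G) :
    haveI := (presentation G hG).prime
    haveI := (presentation G hG).finite
    (model.out G hG).inv = MLFType.ofPadicSubfield (presentation G hG).E := rfl

/-- … in particular, for EVERY presentation `G ≅ G_E` (not only the chosen one).
[cite: MochizukiAbsTopIII2015, Prop 5.8 (i) p. 139] -/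
theorem model_out_inv_eq (G : ProfiniteGrp.{0}) (hG : IsMLFGaloisType G) (P : Presentation G) :
    haveI := P.prime
    haveI := P.finite
    (model.out G hG).inv = MLFType.ofPadicSubfield P.E := by
  haveI := P.prime
  haveI := P.finite
  haveI := (presentation G hG).prime
  haveI := (presentation G hG).finite
  exact MLFType.ofPadicSubfield_eq_of_galEquiv (presentation G hG).E P.E
    ((presentation G hG).iso.symm.trans P.iso)

/-- The log-shell `ℐ(G)` of `model` at `G` is the holomorphic log-shell `ℐ_E ⊆ ℚ̄_p` of the chosen
presenting field `E` (abc-iut-L4-t3's `logShell (PadicLogOnUnits.ofUnitLog p E)`, embedded in `ℚ̄_p`).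
[cite: MochizukiAbsTopIII2015, Prop 5.8 (ii) p. 139] -/
theorem model_out_logShell (G : ProfiniteGrp.{0}) (hG : IsMLFGaloisType G) :
    haveI := (presentation G hG).prime
    haveI := (presentation G hG).finite
    (model.out G hG).logShell =
      ((fun x : (presentation G hG).E => (x : PadicAlgCl (presentation G hG).p)) ''
        AbsoluteAnabelian.logShell (PadicLogOnUnits.ofUnitLog (presentation G hG).p (presentation G hG).E) :
        Set (PadicAlgCl (presentation G hG).p)) := by
  haveI := (presentation G hG).prime
  haveI := (presentation G hG).finite
  letI : MeasurableSpace (presentation G hG).E := borel _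
  haveI : BorelSpace (presentation G hG).E := ⟨rfl⟩
  exact MonoAnalyticNonarch.ofPadicSubfield_logShell (presentation G hG).E

/-- **Mono-analytic log-volume of `ℐ(G)` = holomorphic log-volume of `ℐ_E`, for EVERY presentation
`G ≅ G_E`** ([AbsTopIII] Cor 5.10 (iv)(d); the clause "compatible with … the respective log-shells, and
the respective log-volumes" of [IUTchIII] Prop 1.2 (vi)): the log-volume `μ^log(G)(ℐ(G))`, reconstructed
from the group `G` alone, equals abc-iut-L4-t3's Haar log-volume of the log-shell
`ℐ_E = (p*)⁻¹·log_p(𝒪_E^×)` of any field `E ⊆ ℚ̄_p` with `G ≅ G_E` (this seat's gen-0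
`holMonoVolumeCompatible_ofUnitLog` + the invariance of `(p, f, e, m)`).
[cite: MochizukiAbsTopIII2015, Prop 5.8 (iii) p. 140] -/
theorem model_realLogVol_logShell (G : ProfiniteGrp.{0}) (hG : IsMLFGaloisType G) (P : Presentation G) :
    haveI := P.prime
    haveI := P.finite
    ∀ [MeasurableSpace P.E] [BorelSpace P.E],
      (model.out G hG).realLogVol (model.out G hG).logShell =
        localLogVolume P.E (AbsoluteAnabelian.logShell (PadicLogOnUnits.ofUnitLog P.p P.E)) := by
  haveI := P.prime
  haveI := P.finite
  intro _ _
  rw [(model.out G hG).realLogVol_logShell, model_out_inv_eq G hG P]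
  exact (Literature.IUT.LogThetaLattice.holMonoVolumeCompatible_ofUnitLog P.p P.E
    (MLFType.ofPadicSubfield P.E) rfl rfl rfl rfl).symm

/-- Non-vacuity of abc-iut-L4-t3's hypothesis structure: the algorithm of [AbsTopIII] Prop 5.8 (i)–(iii)
EXISTS (as `model`). [cite: MochizukiAbsTopIII2015, Prop 5.8 (i) p. 139] -/
theorem nonempty : Nonempty MonoAnalyticNonarchAlgorithm.{0} := ⟨model⟩

end MonoAnalyticNonarchAlgorithm

end Literature.AnabelianGeometry.AbsoluteAnabelian

end
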